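import Mathlib.Analysis.Calculus.ContDiff.Basic
import Mathlib.Analysis.SpecialFunctions.ExpDeriv
import Literature.Analysis.FluidPDE.ElgindiFundamentalModel
import Literature.Analysis.FluidPDE.ElgindiWeightedSpaces
import HarnessLib

/-!
# The self-similar and modulated equations of Elgindi and Elgindi–Ghoul–Masmoudi (definitions),
and the rendering of Elgindi's profile theorem

Topic `Literature/Analysis/FluidPDE`. Third file of the self-similar framework
(`ElgindiFundamentalModel.lean`: `K`, `Γ`, `c`, `L₁₂`, `F_*`; `ElgindiWeightedSpaces.lean`: `D_z`,
`D_θ`, the weights and `𝓗ᵏ`) on the decomposition path of the named fact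
`Literature.Analysis.FluidPDE.ElgindiGhoulMasmoudi2021_blowupSolution` (`ElgindiAprioriBlowupProofs.lean`).
Sources: `[Elgindi2021]` = T. M. Elgindi, Ann. of Math. 194 (2021), arXiv:1904.04795;
`[ElgindiGhoulMasmoudi2021]` = Elgindi–Ghoul–Masmoudi, Camb. J. Math. 9 (2021), arXiv:1910.14071
("p." = chunk of the held texts). It **defines** the operators and the three systems of the
sources and **vendors no named fact**; the only proofs are consistency checks. The two theorems
stated in these systems — Elgindi's profile theorem ([Elgindi2021] §9.5) and the swirl-free
stability theorem around that profile ([ElgindiGhoulMasmoudi2021] §2.5 Thm 2, with the §2.6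
datum) — live in the sequel `ElgindiStabilityDecomposition.lean`: the named fact
`ElgindiGhoulMasmoudi2021_stabilityCore` is "the profile (clauses (i)) + Theorem 2 for it
(clause (ii))", the profile theorem on its own is the conclusion of the proved projection
`elgindi2021_selfSimilarProfile_of_stabilityCore`, and the datum is the (discharged) named fact
`ElgindiGhoulMasmoudi2021_compactSupportDatum`. This module docstring keeps the documentation of
how the profile is **rendered** (the amplitude `a`, the `C⁴` clause), to which the sequel refers.

## The printed equations ([ElgindiGhoulMasmoudi2021] §2.2–2.3, p. 7–8; [Elgindi2021] §2.1, p. 8–9)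

Equation references below are by section and content (the held texts carry the LaTeX labels,
not the printed numbers). In the variables `(R, θ)`, `R = ρ^α`, of the axisymmetric swirl-free
Euler equations, with `ω = Ω(R, θ)`, `ψ = ρ²Φ_Ω(R, θ)`, the vorticity equation and the
Biot–Savart law read `∂ₜΩ + U(Φ_Ω)∂_θΩ + V(Φ_Ω) αR∂_RΩ = 𝓡(Φ_Ω)Ω` ([ElgindiGhoulMasmoudi2021]
§2.2 "Evolution equation for `Ω` and `U^φ`", with `U^φ = 0`; [Elgindi2021] §2.1 "Evolution
equation for `Ω`") with `U(Φ) = −3Φ − αR∂_RΦ`, `V(Φ) = ∂_θΦ − tan θ Φ`,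
`𝓡(Φ) = (cos θ)⁻¹(2 sin θ Φ + α sin θ R∂_RΦ + cos θ ∂_θΦ)` (the display following it;
`𝓡(Φ_Ω) = u_r/r`), and `−α²R²∂_RRΦ − α(5+α)R∂_RΦ − ∂_θθΦ + ∂_θ(tan θ Φ) − 6Φ = Ω`,
`Φ(R, 0) = Φ(R, π/2) = 0` (both sources, "Relation between `Φ_Ω` and `Ω`" / "Relation between `Ψ`
and `Ω`", "with the boundary conditions `Φ_Ω(R,0) = Φ_Ω(R,π/2) = 0`"). The **profile system**
for `Ω = (T−t)⁻¹F(R/(T−t)^{1+δ}, θ)`, `Φ_Ω = (T−t)⁻¹Φ_F(z, θ)` ([ElgindiGhoulMasmoudi2021] §2.3,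
"Now we write the equations for `F` and `Φ_F`", p. 7):
`F + (1+δ)z∂_zF + U(Φ_F)∂_θF + αV(Φ_F)z∂_zF = 𝓡(Φ_F)F`, the same elliptic equation for `Φ_F`.
The **modulated system** in `y = μz`, `z = R/λ^{1+δ}`, `ds/dt = λ⁻¹`,
`Ω(R,t,θ) = λ⁻¹W(μR/λ^{1+δ}, s, θ)` (ibid. §2.3, "A natural change of variables", p. 8),
swirl-free case `𝒰^φ ≡ 0` of the system "where `(W, 𝒰^φ, Φ_W)` solves":
`W_s + (μ_s/μ)y∂_yW − (λ_s/λ)S_δ(W) + U(Φ_W)∂_θW + V(Φ_W)αy∂_yW = 𝓡(Φ_W)W`,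
`S_δ(W) = W + (1+δ)y∂_yW`, with the same elliptic problem for `Φ_W(s)`.

## Rendering (definitions)

Curried functions `f z θ` on the open quarter strip `Elgindi.strip = (0,∞) × (0,π/2)`, partial
derivatives through Mathlib's one-variable `deriv` of the slices (`Elgindi.dz`, `Elgindi.dθ`;
`Elgindi.Dz = z∂_z` is the tree's), the operators `Elgindi.opU/opV/opR/opS/ellipticOp` literally as
printed, and three predicates: `Elgindi.IsStreamFunction α W Φ` (the elliptic problem with its
Dirichlet conditions, `Φ` of class `C²` in the open strip and continuous up to `θ ∈ {0, π/2}`),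
`Elgindi.IsProfile α δ F Φ` (the profile system, `F ∈ C¹` of the open strip) and
`Elgindi.IsModulatedSolution α δ W Φ λ μ` (the swirl-free modulated system on `s ≥ 0`: `W`, `Φ`
jointly `C¹` on `(0,∞) × strip`, `W` continuous down to `s = 0`, `λ, μ > 0` continuous on
`[0,∞)` and differentiable on `(0,∞)`, the equations pointwise). Classical pointwise solutions
in the *open* strip are what the sources' solutions are (for `k ≥ 4`, `𝓗ᵏ ⊂ H⁴_loc ⊂ C²` inside;
`ε_s ∈ 𝓗^{k−1}`); nothing is said here about the behaviour at the axis `θ = π/2`, the plane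
`θ = 0` or the blow-up point `z = 0` beyond the Dirichlet conditions — that regularity (the
`C^{1,α}` nature of the physical velocity) belongs to the physical dictionary, not vendored here.
Consistency checks proved: the zero solution, and **a profile is an exactly self-similar
modulated solution** (`W ≡ F`, `λ = e^{−s}`, `μ ≡ 1`; `IsProfile.isModulatedSolution_selfSimilar`),
which is how the profile system sits inside the modulated one.

## The two theorems stated in these systems, and how the profile is rendered (sequel file)

* **Elgindi's profile theorem** ([Elgindi2021] §9, p. 30, and §9.5, p. 34: the `g`-equation
  "has a unique `𝓗⁴` solution in `B_{Cα²}(0)` and vanishing on `θ = 0` and `θ = π/2` when `α` is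
  sufficiently small … `μ` and `λ` are of order `α`. This gives a self similar solution"; recalled
  in [ElgindiGhoulMasmoudi2021] §2.3, p. 7: "there exists a self-similar solution
  `Ω = (T−t)⁻¹F(R/(T−t)^{1+δ}, θ)` where `δ` is a small real number depending on `α` …
  `F = F_* + α²g`, `F_* = (Γ/c)4αz/(1+z)²`, `|g|_{𝓗ᵏ} ≤ C` with `C` a constant independent of
  `α`") is rendered — as clauses (i) of `ElgindiGhoulMasmoudi2021_stabilityCore` and as the
  conclusion of `elgindi2021_selfSimilarProfile_of_stabilityCore` in the sequel — as: there are `C`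
  and `α₀ > 0` such that for all `0 < α < α₀` there are `δ ∈ ℝ` and a solution `(F, Φ_F)` of the
  profile system, classical in the open strip (`Elgindi.IsProfile`), with
  `|F − aF_*|_{𝓗⁴} ≤ Cα²`, `L₁₂(F − aF_*)(0) = 0` for an amplitude `a`, `|a − 1| ≤ Cα`
  (`Elgindi.eHkNorm α 4`, `Elgindi.L12`, `F_* = Elgindi.fundamentalProfile α`), `F` continuous up
  to `θ ∈ {0, π/2}` and vanishing there; `F` is `C⁴` in the open strip ([Elgindi2021] §10, p. 35:
  "the data was `C^∞` except on the whole `x₃`-axis and the `x₃ = 0` plane"; within the recall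
  "`|g|_{𝓗ᵏ} ≤ C`", `𝓗⁶ ⊂ H⁶_loc ⊂ C⁴` inside), which makes `|·|_{𝓗⁴}`, written with classical slice
  derivatives, the genuine norm. Not rendered: uniqueness, the size of `δ`, Elgindi's Theorem 1
  (the infinite-energy physical solution) and the finer `𝓦^{l,∞}` information.
  The amplitude records the normalisation honestly: Elgindi's ansatz
  `Ω = (1 − (1+μ)t)⁻¹F(R/(1−(1+μ)t)^{1+λ})` for the dilated equation `½∂ₜΩ + …` ([Elgindi2021] §9,
  p. 30, `μ, λ = O(α)`, `λ = −2μ/(1+μ)`) turns into the profile system above, with `δ = λ`, for the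
  function `2F/(1+μ) = (1+μ)⁻¹F_* + 2g/(1+μ)` (the quadratic terms absorb the factor), an
  `𝓗⁴`-perturbation of `(1+μ)⁻¹F_*` and not of `F_*` (`F_* ∉ 𝓗⁰`: `F_*w ∼ 4αΓ/(cz)` at `z → 0`),
  which [ElgindiGhoulMasmoudi2021] §2.3 abbreviate as "`F = F_* + α²g`"; so `a = (1+μ)⁻¹`,
  `|g|_{𝓗⁴} ≤ Cα²`, `L₁₂(g)(0) = 0`, `μ = O(α)` give the clauses, and `a = 1` is not asserted.
  (Earlier versions of this file vendored this statement as a named fact of its own,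
  `Elgindi2021_selfSimilarProfile`; its body being clause (i) of the core verbatim — Theorem 2
  cannot be stated without the profile witnesses, so the profile can only be duplicated next to
  the core, not factored out of it — it was **merged back** into the core under the D-0026 review
  of decompositions and is no longer declared; the statement survives, with its citation, as the
  conclusion of `elgindi2021_selfSimilarProfile_of_stabilityCore`.)
* The **swirl-free stability theorem** for this profile — [ElgindiGhoulMasmoudi2021] §2.5
  **Theorem 2** (p. 9) for `k = 4` and `𝒰^φ ≡ 0` (an invariant class: the first equation of the
  modulated system is linear homogeneous in `𝒰^φ` and the printed solution is unique), i.e. for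
  data `ε₀ ∈ C⁴(strip)` with `|ε₀|_{𝓗⁴} < δ₀α^{3/2}`, `L₁₂(ε₀)(0) = 0` a global modulated solution
  (`Elgindi.IsModulatedSolution`) with `W(0) = F + ε₀`, `λ(0) = μ(0) = 1`,
  `|μ_s| + |λ_s/λ + 1| ≤ C|ε₀|_{𝓗⁴}e^{−κs}`, `|W(s) − F|_{𝓗⁰} ≤ C|ε₀|_{𝓗⁴}e^{−κs}` — together with the
  **§2.6 datum** (p. 9: "it suffices to show that there exists `ε₀ ∈ 𝓗ᵏ` with small norm so that
  `F + ε₀` is compactly supported") is vendored in `ElgindiStabilityDecomposition.lean` as the two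
  named facts `ElgindiGhoulMasmoudi2021_stabilityCore` (profile + Theorem 2) and
  `ElgindiGhoulMasmoudi2021_compactSupportDatum` (§2.6), glued there by the proved
  `stabilityNoSwirl_of_core_of_datum`. (An earlier version of this file vendored their
  conjunction as a third named fact `ElgindiGhoulMasmoudi2021_stabilityNoSwirl`; equivalent to the
  core modulo the elementary datum fact, it was merged back into those two under the D-0026
  review of decompositions and is no longer declared.)

Downstream: the stable blow-up solution with its physical reading on `ℝ³`
(`ElgindiStableBlowupPhysical.lean`, named fact `ElgindiGhoulMasmoudi2021_stableBlowupPhysical`) and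
the assembly of `ElgindiGhoulMasmoudi2021_blowupSolution` from it (`ElgindiBlowupSolutionProofs.lean`,
using the non-triviality of the profile, `ElgindiProfileNontrivial.lean`); the real-variable
content of Cor. 2.2 is `DynamicRescalingBKM.lean`.
-/

noncomputable section

open Set Function Real
open scoped ENNReal ContDiff

namespace Literature.Analysis.FluidPDE

namespace Elgindi

/-! ### Partial derivatives and the operators `U`, `V`, `𝓡`, `S_δ`, and the elliptic operator -/

/-- `∂_z f` on curried functions (slice derivative in the first variable). [folklore] -/
def dz (f : ℝ → ℝ → ℝ) (z θ : ℝ) : ℝ :=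
  deriv (fun z' => f z' θ) z

/-- `∂_θ f` on curried functions (slice derivative in the second variable). [folklore] -/
def dθ (f : ℝ → ℝ → ℝ) (z θ : ℝ) : ℝ :=
  deriv (fun θ' => f z θ') θ

/-- `D_z = z∂_z` in terms of `∂_z`. [folklore] -/
theorem Dz_eq_mul_dz (f : ℝ → ℝ → ℝ) (z θ : ℝ) : Dz f z θ = z * dz f z θ := rfl

/-- `D_θ = sin(2θ)∂_θ` in terms of `∂_θ`. [folklore] -/
theorem Dθ_eq_mul_dθ (f : ℝ → ℝ → ℝ) (z θ : ℝ) : Dθ f z θ = Real.sin (2 * θ) * dθ f z θ := rfl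

/-- The angular transport coefficient `U(Φ) = −3Φ − αR∂_RΦ` (Elgindi–Ghoul–Masmoudi 2021, §2.2,
the display defining `U`, `V`, `𝓡`; Elgindi 2021, §2.1). [cite: ElgindiGhoulMasmoudi2021, §2.2 (p. 7 of arXiv:1910.14071): U(Φ_Ω) = −3Φ_Ω − αR∂_RΦ_Ω] -/
def opU (α : ℝ) (Φ : ℝ → ℝ → ℝ) (z θ : ℝ) : ℝ :=
  -3 * Φ z θ - α * Dz Φ z θ

/-- The radial transport coefficient `V(Φ) = ∂_θΦ − tan θ Φ` (Elgindi–Ghoul–Masmoudi 2021, §2.2,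
the display defining `U`, `V`, `𝓡`; Elgindi 2021, §2.1). [cite: ElgindiGhoulMasmoudi2021, §2.2 (p. 7): V(Φ_Ω) = ∂_θΦ_Ω − tan(θ)Φ_Ω] -/
def opV (Φ : ℝ → ℝ → ℝ) (z θ : ℝ) : ℝ :=
  dθ Φ z θ - Real.tan θ * Φ z θ

/-- The stretching coefficient `𝓡(Φ) = (cos θ)⁻¹(2 sin θ Φ + α sin θ R∂_RΦ + cos θ ∂_θΦ)`
(`= u_r/r`; Elgindi–Ghoul–Masmoudi 2021, §2.2, the display defining `U`, `V`, `𝓡`; Elgindi 2021,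
§2.1). Junk on the axis `θ = π/2` (division by `cos θ = 0`), outside the open strip. [cite: ElgindiGhoulMasmoudi2021, §2.2 (p. 7): 𝓡(Φ_Ω) = (1/cos θ)(2 sin θ Ψ + α sin θ R∂_RΨ + cos θ ∂_θΨ)] -/
def opR (α : ℝ) (Φ : ℝ → ℝ → ℝ) (z θ : ℝ) : ℝ :=
  (2 * Real.sin θ * Φ z θ + α * Real.sin θ * Dz Φ z θ + Real.cos θ * dθ Φ z θ) / Real.cos θ

/-- The scaling generator `S_δ(W) = W + (1+δ)y∂_yW` (Elgindi–Ghoul–Masmoudi 2021, §2.3, after the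
modulated system). [cite: ElgindiGhoulMasmoudi2021, §2.3 (p. 8): S_δ(W) = W + (1+δ)y∂_yW] -/
def opS (δ : ℝ) (W : ℝ → ℝ → ℝ) (z θ : ℝ) : ℝ :=
  W z θ + (1 + δ) * Dz W z θ

/-- The elliptic operator of the Biot–Savart law in `(R, θ)` variables,
`−α²R²∂_RRΦ − α(5+α)R∂_RΦ − ∂_θθΦ + ∂_θ(tan θ Φ) − 6Φ` (Elgindi–Ghoul–Masmoudi 2021, §2.2
"Relation between `Φ_Ω` and `Ω`", repeated in §2.3 for `Φ_F` and `Φ_W`; Elgindi 2021, §2.1,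
"Relation between `Ψ` and `Ω`"). [cite: ElgindiGhoulMasmoudi2021, §2.2 (p. 7) and §2.3 (p. 7–8): the elliptic relation between Φ and the vorticity]
[cite: Elgindi2021, §2.1 (p. 9 of arXiv:1904.04795), the relation between Ψ and Ω] -/
def ellipticOp (α : ℝ) (Φ : ℝ → ℝ → ℝ) (z θ : ℝ) : ℝ :=
  -α ^ 2 * z ^ 2 * dz (dz Φ) z θ - α * (5 + α) * z * dz Φ z θ - dθ (dθ Φ) z θ +
    dθ (fun z' θ' => Real.tan θ' * Φ z' θ') z θ - 6 * Φ z θ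

/-- `∂_z 0 = 0`. [folklore] -/
@[simp] theorem dz_zero : dz 0 = 0 := by funext z θ; simp [dz]

/-- `∂_θ 0 = 0`. [folklore] -/
@[simp] theorem dθ_zero : dθ 0 = 0 := by funext z θ; simp [dθ]

/-- `U(0) = 0`. [folklore] -/
@[simp] theorem opU_zero (α : ℝ) : opU α 0 = 0 := by funext z θ; simp [opU]

/-- `V(0) = 0`. [folklore] -/
@[simp] theorem opV_zero : opV 0 = 0 := by funext z θ; simp [opV]

/-- `𝓡(0) = 0`. [folklore] -/
@[simp] theorem opR_zero (α : ℝ) : opR α 0 = 0 := by funext z θ; simp [opR]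

/-- `S_δ(0) = 0`. [folklore] -/
@[simp] theorem opS_zero (δ : ℝ) : opS δ 0 = 0 := by funext z θ; simp [opS]

/-- The elliptic operator kills `0`. [folklore] -/
@[simp] theorem ellipticOp_zero (α : ℝ) : ellipticOp α 0 = 0 := by
  funext z θ
  simp [ellipticOp, dz, dθ]

/-! ### The three systems -/

/-- **The Biot–Savart problem in `(R, θ)` / self-similar variables**: `Φ` solves
`−α²z²∂_zzΦ − α(5+α)z∂_zΦ − ∂_θθΦ + ∂_θ(tan θ Φ) − 6Φ = W` in the open quarter strip, is `C²`
there, continuous up to `θ ∈ {0, π/2}`, and satisfies the Dirichlet conditions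
`Φ(z, 0) = Φ(z, π/2) = 0` (Elgindi–Ghoul–Masmoudi 2021, §2.2 "Relation between `Φ_Ω` and `Ω`",
"with the boundary conditions `Φ_Ω(R,0) = Φ_Ω(R,π/2) = 0`", repeated in §2.3 for `Φ_F`, `Φ_W`;
Elgindi 2021, §2.1). Classical pointwise rendering; growth conditions at `z → 0, ∞` (which single
out the physical solution) are not part of the predicate. [cite: ElgindiGhoulMasmoudi2021, §2.2 (p. 7): the elliptic problem with its boundary conditions] -/
structure IsStreamFunction (α : ℝ) (W Φ : ℝ → ℝ → ℝ) : Prop where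
  /-- `Φ` is `C²` in the open strip. -/
  contDiffOn : ContDiffOn ℝ 2 (uncurry Φ) strip
  /-- `Φ` is continuous up to the sides `θ = 0`, `θ = π/2`. -/
  continuousOn : ContinuousOn (uncurry Φ) (Set.Ioi 0 ×ˢ Set.Icc 0 (π / 2))
  /-- The elliptic equation, pointwise in the open strip. -/
  elliptic : ∀ z θ, (z, θ) ∈ strip → ellipticOp α Φ z θ = W z θ
  /-- Dirichlet condition on the symmetry plane `θ = 0`. -/
  bc_zero : ∀ z, 0 < z → Φ z 0 = 0
  /-- Dirichlet condition on the axis `θ = π/2`. -/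
  bc_pi_div_two : ∀ z, 0 < z → Φ z (π / 2) = 0

/-- **The self-similar profile system** (Elgindi–Ghoul–Masmoudi 2021, §2.3, "Now we write the
equations for `F` and `Φ_F`", p. 7; the equations for `Ω = (T−t)⁻¹F(R/(T−t)^{1+δ}, θ)`,
`Φ_Ω = (T−t)⁻¹Φ_F`): `F + (1+δ)z∂_zF + U(Φ_F)∂_θF + αV(Φ_F)z∂_zF = 𝓡(Φ_F)F` pointwise in the open
strip, `F ∈ C¹` there, and `Φ_F` the stream function of `F`. [cite: ElgindiGhoulMasmoudi2021, §2.3 (p. 7 of arXiv:1910.14071): the equations for F and Φ_F] -/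
structure IsProfile (α δ : ℝ) (F Φ : ℝ → ℝ → ℝ) : Prop where
  /-- `F` is `C¹` in the open strip. -/
  contDiffOn : ContDiffOn ℝ 1 (uncurry F) strip
  /-- `Φ = Φ_F` solves the Biot–Savart problem for `F`. -/
  stream : IsStreamFunction α F Φ
  /-- The profile equation, pointwise in the open strip. -/
  profileEq : ∀ z θ, (z, θ) ∈ strip →
    F z θ + (1 + δ) * Dz F z θ + opU α Φ z θ * dθ F z θ + α * opV Φ z θ * Dz F z θ =
      opR α Φ z θ * F z θ

/-- **The swirl-free modulated system** (Elgindi–Ghoul–Masmoudi 2021, §2.3, the system "where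
`(W, 𝒰^φ, Φ_W)` solves" with `𝒰^φ ≡ 0`, p. 8), for `W(s, y, θ)`, `Φ_W(s, y, θ)` (curried `W s y θ`)
and the modulation
parameters `λ(s), μ(s)`, `s ≥ 0`:
`W_s + (μ_s/μ)y∂_yW − (λ_s/λ)S_δ(W) + U(Φ_W)∂_θW + V(Φ_W)αy∂_yW = 𝓡(Φ_W)W` pointwise for `s > 0`
in the open strip, `Φ_W(s)` the stream function of `W(s)` for every `s ≥ 0`; `W`, `Φ_W` jointly
`C¹` on `(0,∞) × strip`, `W` continuous on `[0,∞) × strip`; `λ, μ > 0`, continuous on `[0, ∞)`,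
differentiable on `(0, ∞)`. Classical rendering of the "global solution" of Thm 2. [cite: ElgindiGhoulMasmoudi2021, §2.3 (p. 8 of arXiv:1910.14071): the change of variables and the modulated system] -/
structure IsModulatedSolution (α δ : ℝ) (W Φ : ℝ → ℝ → ℝ → ℝ) (lam mu : ℝ → ℝ) : Prop where
  /-- `W` is `C¹` in `(s, y, θ)` for `s > 0`. -/
  contDiffOn : ContDiffOn ℝ 1 (fun p : ℝ × ℝ × ℝ => W p.1 p.2.1 p.2.2) (Set.Ioi 0 ×ˢ strip)
  /-- `W` is continuous down to `s = 0`. -/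
  continuousOn : ContinuousOn (fun p : ℝ × ℝ × ℝ => W p.1 p.2.1 p.2.2) (Set.Ici 0 ×ˢ strip)
  /-- `Φ_W` is `C¹` in `(s, y, θ)` for `s > 0`. -/
  contDiffOn_stream : ContDiffOn ℝ 1 (fun p : ℝ × ℝ × ℝ => Φ p.1 p.2.1 p.2.2) (Set.Ioi 0 ×ˢ strip)
  /-- `Φ_W(s)` is the stream function of `W(s)` (the elliptic problem with its boundary conditions). -/
  stream : ∀ s, 0 ≤ s → IsStreamFunction α (W s) (Φ s)
  /-- `λ > 0`. -/
  lam_pos : ∀ s, 0 ≤ s → 0 < lam s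
  /-- `μ > 0`. -/
  mu_pos : ∀ s, 0 ≤ s → 0 < mu s
  /-- `λ` is continuous on `[0, ∞)`. -/
  lam_continuousOn : ContinuousOn lam (Set.Ici 0)
  /-- `μ` is continuous on `[0, ∞)`. -/
  mu_continuousOn : ContinuousOn mu (Set.Ici 0)
  /-- `λ` is differentiable on `(0, ∞)`. -/
  lam_differentiableAt : ∀ s, 0 < s → DifferentiableAt ℝ lam s
  /-- `μ` is differentiable on `(0, ∞)`. -/
  mu_differentiableAt : ∀ s, 0 < s → DifferentiableAt ℝ mu s
  /-- The modulated vorticity equation (swirl-free), pointwise for `s > 0` in the strip. -/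
  evolution : ∀ s, 0 < s → ∀ y θ, (y, θ) ∈ strip →
    deriv (fun s' => W s' y θ) s + deriv mu s / mu s * Dz (W s) y θ -
        deriv lam s / lam s * opS δ (W s) y θ +
        opU α (Φ s) y θ * dθ (W s) y θ + opV (Φ s) y θ * (α * Dz (W s) y θ) =
      opR α (Φ s) y θ * W s y θ

/-! ### Consistency checks -/

/-- The zero stream function solves the Biot–Savart problem for `W = 0`. [folklore] -/
theorem IsStreamFunction.zero (α : ℝ) : IsStreamFunction α 0 0 where
  contDiffOn := contDiffOn_const
  continuousOn := continuousOn_const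
  elliptic z θ _ := by simp
  bc_zero _ _ := rfl
  bc_pi_div_two _ _ := rfl

/-- The trivial profile `F = 0` (the predicate is a system of equations, not the theorem). [folklore] -/
theorem IsProfile.zero (α δ : ℝ) : IsProfile α δ 0 0 where
  contDiffOn := contDiffOn_const
  stream := IsStreamFunction.zero α
  profileEq z θ _ := by simp [Dz, dθ]

/-- **A profile is an exactly self-similar modulated solution**: `W(s) ≡ F`, `Φ_W(s) ≡ Φ_F`,
`λ(s) = e^{−s}`, `μ ≡ 1` solve the modulated system — `μ_s = 0`, `λ_s/λ = −1` turn the modulated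
equation into the profile equation (Elgindi–Ghoul–Masmoudi 2021, §1.4: "Observe that
`(λ̃(t), μ̃(t), G(·,t)) = ((1−t), 1, Ḡ)` is an exact solution"; §2.3). [cite: ElgindiGhoulMasmoudi2021, §1.4 (p. 3–4) and §2.3 (p. 7–8)] -/
theorem IsProfile.isModulatedSolution_selfSimilar {α δ : ℝ} {F Φ : ℝ → ℝ → ℝ}
    (h : IsProfile α δ F Φ) :
    IsModulatedSolution α δ (fun _ => F) (fun _ => Φ) (fun s => Real.exp (-s)) (fun _ => 1) where
  contDiffOn := h.contDiffOn.comp (contDiffOn_snd (𝕜 := ℝ)) fun p hp => hp.2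
  continuousOn := h.contDiffOn.continuousOn.comp continuousOn_snd fun p hp => hp.2
  contDiffOn_stream := h.stream.contDiffOn.of_le (by norm_num) |>.comp
    (contDiffOn_snd (𝕜 := ℝ)) fun p hp => hp.2
  stream _ _ := h.stream
  lam_pos _ _ := Real.exp_pos _
  mu_pos _ _ := one_pos
  lam_continuousOn := (Real.continuous_exp.comp continuous_neg).continuousOn
  mu_continuousOn := continuousOn_const
  lam_differentiableAt s _ := (Real.differentiable_exp.comp differentiable_neg) s
  mu_differentiableAt _ _ := differentiableAt_const _
  evolution s _ y θ hyθ := by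
    have hd : deriv (fun s => Real.exp (-s)) s = -Real.exp (-s) := by
      simpa using ((hasDerivAt_neg s).exp).deriv
    have he : Real.exp (-s) ≠ 0 := (Real.exp_pos _).ne'
    simp only [deriv_const', hd, neg_div, div_self he, zero_div, zero_mul, add_zero, opS]
    have key := h.profileEq y θ hyθ
    linear_combination key

end Elgindi

end Literature.Analysis.FluidPDE
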